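import Mathlib
import Summits.Ventures.HodgeRepro2.T5AdicCompletionIntegralBasis
import Summits.Ventures.HodgeRepro2.T5QuadraticAutomorphism
import Summits.Ventures.HodgeRepro2.T5AdicCompletionGaloisInvariance
import Summits.Ventures.HodgeRepro2.T5QuadraticGalois

/-!
# The conjugation of `Lw/Kv` restricted to `O_Lw`, and the three numbers of N5.15.2 (A15) with
  NO datum hypothesis left

`Kv ⊆ Lw` Mathlib's completions (number fields, `w ∣ v`), `[Lw : Kv] = 2`, `σ : Lw ≃ₐ[Kv] Lw` any
NON-TRIVIAL automorphism (it exists at an inert place — this is the Galois hypothesis of the datum,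
the only input besides inertness).  `T5AdicCompletionGaloisInvariance` gives `w(σ z) = w z`, so `σ`
restricts to a ring automorphism `restrictIntegers σ` of `O_Lw`; `T5QuadraticAutomorphism` gives
`σ ∘ σ = id` and «the fixed elements of `σ` are `Kv`», and `T5ContinuousValuationExtension` turns
the latter into «the fixed elements of `restrictIntegers σ` are `O_Kv`».  Hence every hypothesis
of `T5AdicCompletionIntegralBasis` is met and

* `exists_integralBasis`: ∃ θ ∈ O_Lw with `θ − σ θ` a unit and `O_Lw = O_Kv ⊕ O_Kv θ`;
* `relIndex_range_inf_higherUnits_eq` / `_two` / `_one`, `relIndex_inf_two_inf_one`: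
  `[E¹ : E¹ ∩ U^n] = (N(v)+1) N(v)^{n−1}`, `(N(v)+1) N(v)`, `N(v) + 1`, `N(v)` — N5.15.2 (A15) /
  N5.T3 l. 450 on Mathlib's objects, hypotheses: number fields, `w ∣ v`, `[Lw : Kv] = 2`, a common
  uniformiser (inert), `σ ≠ 1` — and `σ` itself EXISTS (`T5QuadraticGalois`: a separable quadratic
  extension has a non-trivial automorphism), so the last section states the counts with no `σ` at all.

Declaration per README §8(d): «uses an L-value-free non-vanishing device: NO».
-/

namespace Summit.Ventures.HodgeRepro2.T5AdicCompletionConjugation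

open IsDedekindDomain HeightOneSpectrum IsLocalRing T5FiltrationHilbert90 T5PrincipalUnitFiltration

variable {K : Type*} [Field K] [NumberField K] (v : HeightOneSpectrum (NumberField.RingOfIntegers K))
  {L : Type*} [Field L] [NumberField L] [Algebra K L]
  (w : HeightOneSpectrum (NumberField.RingOfIntegers L)) [w.asIdeal.LiesOver v.asIdeal]

/-- `σ` preserves the valuation ring `O_Lw` (`w(σ z) = w z`). -/
theorem apply_mem_adicCompletionIntegers (σ : adicCompletion L w ≃ₐ[adicCompletion K v] adicCompletion L w)
    {z : adicCompletion L w} (hz : z ∈ adicCompletionIntegers L w) :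
    σ z ∈ adicCompletionIntegers L w := by
  rw [mem_adicCompletionIntegers] at hz ⊢
  rwa [T5AdicCompletionGaloisInvariance.val_algEquiv_apply v w σ z]

/-- The restriction of `σ` to `O_Lw` as a ring automorphism. -/
noncomputable def restrictIntegers (σ : adicCompletion L w ≃ₐ[adicCompletion K v] adicCompletion L w) :
    adicCompletionIntegers L w ≃+* adicCompletionIntegers L w where
  toFun z := ⟨σ z, apply_mem_adicCompletionIntegers v w σ z.2⟩
  invFun z := ⟨σ.symm z, apply_mem_adicCompletionIntegers v w σ.symm z.2⟩
  left_inv z := Subtype.ext (by simp)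
  right_inv z := Subtype.ext (by simp)
  map_mul' a b := Subtype.ext (by simp)
  map_add' a b := Subtype.ext (by simp)

/-- The value of `restrictIntegers σ z` in `Lw` is `σ z`. -/
@[simp]
theorem coe_restrictIntegers (σ : adicCompletion L w ≃ₐ[adicCompletion K v] adicCompletion L w)
    (z : adicCompletionIntegers L w) :
    ((restrictIntegers v w σ z : adicCompletionIntegers L w) : adicCompletion L w) = σ z := rfl

/-- `restrictIntegers σ` fixes the image of `O_Kv`. -/
theorem restrictIntegers_algebraMap
    (σ : adicCompletion L w ≃ₐ[adicCompletion K v] adicCompletion L w)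
    (r : adicCompletionIntegers K v) :
    restrictIntegers v w σ (algebraMap (adicCompletionIntegers K v) (adicCompletionIntegers L w) r) =
      algebraMap (adicCompletionIntegers K v) (adicCompletionIntegers L w) r := by
  apply Subtype.ext
  rw [coe_restrictIntegers]
  exact σ.commutes (r : adicCompletion K v)

/-- `restrictIntegers σ` is an involution when `[Lw : Kv] = 2` and `σ ≠ 1`. -/
theorem restrictIntegers_restrictIntegers
    (h2 : Module.finrank (adicCompletion K v) (adicCompletion L w) = 2)
    (σ : adicCompletion L w ≃ₐ[adicCompletion K v] adicCompletion L w) (hσ : σ ≠ 1)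
    (z : adicCompletionIntegers L w) :
    restrictIntegers v w σ (restrictIntegers v w σ z) = z := by
  apply Subtype.ext
  rw [coe_restrictIntegers, coe_restrictIntegers]
  exact T5QuadraticAutomorphism.apply_apply h2 σ hσ z

/-- The FIXED elements of `restrictIntegers σ` come from `O_Kv` (`[Lw : Kv] = 2`, `σ ≠ 1`): a fixed
`z` lies in `Kv` by `T5QuadraticAutomorphism.mem_range_of_fixed`, and `w z ≤ 1` forces `v ≤ 1` on its
preimage (`T5ContinuousValuationExtension.val_algebraMap_le_one_iff`). -/
theorem exists_algebraMap_eq_of_restrictIntegers_eq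
    (h2 : Module.finrank (adicCompletion K v) (adicCompletion L w) = 2)
    (σ : adicCompletion L w ≃ₐ[adicCompletion K v] adicCompletion L w) (hσ : σ ≠ 1)
    {z : adicCompletionIntegers L w} (hz : restrictIntegers v w σ z = z) :
    ∃ r : adicCompletionIntegers K v,
      z = algebraMap (adicCompletionIntegers K v) (adicCompletionIntegers L w) r := by
  have hz' : σ (z : adicCompletion L w) = z := by
    have := congrArg (fun y : adicCompletionIntegers L w => (y : adicCompletion L w)) hz
    simpa using this
  obtain ⟨x, hx⟩ := T5QuadraticAutomorphism.mem_range_of_fixed h2 σ hσ hz'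
  have hxmem : x ∈ adicCompletionIntegers K v := by
    rw [mem_adicCompletionIntegers]
    rw [← T5ContinuousValuationExtension.val_algebraMap_le_one_iff (K := K) (L := L) (v := v) (w := w) x, hx]
    exact (mem_adicCompletionIntegers (NumberField.RingOfIntegers L) L w).1 z.2
  refine ⟨⟨x, hxmem⟩, ?_⟩
  apply Subtype.ext
  exact hx.symm

/-- THE UNRAMIFIED INTEGRAL BASIS on Mathlib's completions from `[Lw : Kv] = 2`, a common uniformiser
and a non-trivial automorphism: ∃ θ ∈ O_Lw, `θ − σ θ` a unit and `O_Lw = O_Kv ⊕ O_Kv θ`. -/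
theorem exists_integralBasis
    (h2 : Module.finrank (adicCompletion K v) (adicCompletion L w) = 2)
    (σ : adicCompletion L w ≃ₐ[adicCompletion K v] adicCompletion L w) (hσ : σ ≠ 1)
    {ϖ : adicCompletionIntegers K v} (hϖ : Irreducible ϖ)
    (hϖS : Irreducible (algebraMap (adicCompletionIntegers K v) (adicCompletionIntegers L w) ϖ)) :
    ∃ θ : adicCompletionIntegers L w, IsUnit (θ - restrictIntegers v w σ θ) ∧
      ∀ s : adicCompletionIntegers L w, ∃ a b : adicCompletionIntegers K v,
        s = algebraMap _ _ a + algebraMap _ _ b * θ :=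
  T5AdicCompletionIntegralBasis.exists_integralBasis v w (restrictIntegers v w σ)
    (restrictIntegers_restrictIntegers v w h2 σ hσ)
    (fun _ hs => exists_algebraMap_eq_of_restrictIntegers_eq v w h2 σ hσ hs) h2 hϖ hϖS

/-- N5.15.2 (A15) / N5.T3 l. 450 on Mathlib's completions, NO datum hypothesis left:
`[E¹ : E¹ ∩ U^n] = (N(v)+1) N(v)^{n−1}` (`n ≥ 1`). -/
theorem relIndex_range_inf_higherUnits_eq
    (h2 : Module.finrank (adicCompletion K v) (adicCompletion L w) = 2)
    (σ : adicCompletion L w ≃ₐ[adicCompletion K v] adicCompletion L w) (hσ : σ ≠ 1)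
    {ϖ : adicCompletionIntegers K v} (hϖ : Irreducible ϖ)
    (hϖS : Irreducible (algebraMap (adicCompletionIntegers K v) (adicCompletionIntegers L w) ϖ))
    {n : ℕ} (hn : 1 ≤ n) :
    ((MonoidHom.mk' (conjQuot (restrictIntegers v w σ)) (conjQuot_mul _)).range ⊓
        higherUnits (algebraMap _ _ ϖ) n).relIndex
        (MonoidHom.mk' (conjQuot (restrictIntegers v w σ)) (conjQuot_mul _)).range =
      (Ideal.absNorm v.asIdeal + 1) * Ideal.absNorm v.asIdeal ^ (n - 1) :=
  T5AdicCompletionIntegralBasis.relIndex_range_inf_higherUnits_eq v w (restrictIntegers v w σ)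
    (restrictIntegers_algebraMap v w σ) (restrictIntegers_restrictIntegers v w h2 σ hσ)
    (fun _ hs => exists_algebraMap_eq_of_restrictIntegers_eq v w h2 σ hσ hs) h2 hϖ hϖS hn

/-- `|E¹/(E¹ ∩ U²)| = (N(v)+1) N(v)`. -/
theorem relIndex_range_inf_higherUnits_two
    (h2 : Module.finrank (adicCompletion K v) (adicCompletion L w) = 2)
    (σ : adicCompletion L w ≃ₐ[adicCompletion K v] adicCompletion L w) (hσ : σ ≠ 1)
    {ϖ : adicCompletionIntegers K v} (hϖ : Irreducible ϖ)
    (hϖS : Irreducible (algebraMap (adicCompletionIntegers K v) (adicCompletionIntegers L w) ϖ)) :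
    ((MonoidHom.mk' (conjQuot (restrictIntegers v w σ)) (conjQuot_mul _)).range ⊓
        higherUnits (algebraMap _ _ ϖ) 2).relIndex
        (MonoidHom.mk' (conjQuot (restrictIntegers v w σ)) (conjQuot_mul _)).range =
      (Ideal.absNorm v.asIdeal + 1) * Ideal.absNorm v.asIdeal :=
  T5AdicCompletionIntegralBasis.relIndex_range_inf_higherUnits_two v w (restrictIntegers v w σ)
    (restrictIntegers_algebraMap v w σ) (restrictIntegers_restrictIntegers v w h2 σ hσ)
    (fun _ hs => exists_algebraMap_eq_of_restrictIntegers_eq v w h2 σ hσ hs) h2 hϖ hϖS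

/-- `|G/G¹| = |E¹/(E¹ ∩ U¹)| = N(v) + 1`. -/
theorem relIndex_range_inf_higherUnits_one
    (h2 : Module.finrank (adicCompletion K v) (adicCompletion L w) = 2)
    (σ : adicCompletion L w ≃ₐ[adicCompletion K v] adicCompletion L w) (hσ : σ ≠ 1)
    {ϖ : adicCompletionIntegers K v} (hϖ : Irreducible ϖ)
    (hϖS : Irreducible (algebraMap (adicCompletionIntegers K v) (adicCompletionIntegers L w) ϖ)) :
    ((MonoidHom.mk' (conjQuot (restrictIntegers v w σ)) (conjQuot_mul _)).range ⊓
        higherUnits (algebraMap _ _ ϖ) 1).relIndex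
        (MonoidHom.mk' (conjQuot (restrictIntegers v w σ)) (conjQuot_mul _)).range =
      Ideal.absNorm v.asIdeal + 1 :=
  T5AdicCompletionIntegralBasis.relIndex_range_inf_higherUnits_one v w (restrictIntegers v w σ)
    (restrictIntegers_algebraMap v w σ) (restrictIntegers_restrictIntegers v w h2 σ hσ)
    (fun _ hs => exists_algebraMap_eq_of_restrictIntegers_eq v w h2 σ hσ hs) h2 hϖ hϖS

/-- `|G¹| = |(E¹ ∩ U¹)/(E¹ ∩ U²)| = N(v)`. -/
theorem relIndex_inf_two_inf_one
    (h2 : Module.finrank (adicCompletion K v) (adicCompletion L w) = 2)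
    (σ : adicCompletion L w ≃ₐ[adicCompletion K v] adicCompletion L w) (hσ : σ ≠ 1)
    {ϖ : adicCompletionIntegers K v} (hϖ : Irreducible ϖ)
    (hϖS : Irreducible (algebraMap (adicCompletionIntegers K v) (adicCompletionIntegers L w) ϖ)) :
    ((MonoidHom.mk' (conjQuot (restrictIntegers v w σ)) (conjQuot_mul _)).range ⊓
        higherUnits (algebraMap _ _ ϖ) 2).relIndex
        ((MonoidHom.mk' (conjQuot (restrictIntegers v w σ)) (conjQuot_mul _)).range ⊓
          higherUnits (algebraMap _ _ ϖ) 1) = Ideal.absNorm v.asIdeal :=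
  T5AdicCompletionIntegralBasis.relIndex_inf_two_inf_one v w (restrictIntegers v w σ)
    (restrictIntegers_algebraMap v w σ) (restrictIntegers_restrictIntegers v w h2 σ hσ)
    (fun _ hs => exists_algebraMap_eq_of_restrictIntegers_eq v w h2 σ hσ hs) h2 hϖ hϖS

section SigmaFree

/-- A non-trivial `Kv`-automorphism of `Lw` exists when `[Lw : Kv] = 2` (`Kv` has characteristic `0`,
so `Lw/Kv` is separable). -/
theorem exists_algEquiv_ne_one
    (h2 : Module.finrank (adicCompletion K v) (adicCompletion L w) = 2) :
    ∃ σ : adicCompletion L w ≃ₐ[adicCompletion K v] adicCompletion L w, σ ≠ 1 :=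
  T5QuadraticGalois.exists_ne_one h2

/-- N5.15.2 (A15) / N5.T3 l. 450 with NO `σ` in the hypotheses: for some (any) non-trivial
automorphism `σ`, `[E¹ : E¹ ∩ U^n] = (N(v)+1) N(v)^{n−1}`. -/
theorem exists_algEquiv_relIndex_range_inf_higherUnits_eq
    (h2 : Module.finrank (adicCompletion K v) (adicCompletion L w) = 2)
    {ϖ : adicCompletionIntegers K v} (hϖ : Irreducible ϖ)
    (hϖS : Irreducible (algebraMap (adicCompletionIntegers K v) (adicCompletionIntegers L w) ϖ))
    {n : ℕ} (hn : 1 ≤ n) :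
    ∃ σ : adicCompletion L w ≃ₐ[adicCompletion K v] adicCompletion L w, σ ≠ 1 ∧
      ((MonoidHom.mk' (conjQuot (restrictIntegers v w σ)) (conjQuot_mul _)).range ⊓
          higherUnits (algebraMap _ _ ϖ) n).relIndex
          (MonoidHom.mk' (conjQuot (restrictIntegers v w σ)) (conjQuot_mul _)).range =
        (Ideal.absNorm v.asIdeal + 1) * Ideal.absNorm v.asIdeal ^ (n - 1) := by
  obtain ⟨σ, hσ⟩ := exists_algEquiv_ne_one v w h2
  exact ⟨σ, hσ, relIndex_range_inf_higherUnits_eq v w h2 σ hσ hϖ hϖS hn⟩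

end SigmaFree

end Summit.Ventures.HodgeRepro2.T5AdicCompletionConjugation
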